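import Literature.MathematicalPhysics.KineticTheory.ReyBelletThomas2002Dissipation
import Literature.MathematicalPhysics.KineticTheory.ReyBelletThomas2002ExpMartingale
import Literature.MathematicalPhysics.KineticTheory.ReyBelletThomas2002Thm21Final
import Literature.MathematicalPhysics.KineticTheory.LangevinChainTheorem51
import Mathlib.MeasureTheory.Integral.MeanInequalities
import HarnessLib

/-!
# Rey-Bellet–Thomas 2002, Theorem 3.10 (the Liapunov bound) and Theorem 2.1 for `k₁ = k₂`, proved

Trunk T-KINETIC (Literature/MathematicalPhysics/KineticTheory). Rey-Bellet–Thomas, CMP 225 (2002),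
Theorem 3.10: for `s > 0` and `0 < θ < 1/max(T_L, T_R)` there are a compact `U` and `κ < 1`, `L`
with `T^s e^{θG}(x) ≤ κ e^{θG(x)} + L 1_U(x)`. This file PROVES it for the transition kernels
`rbKernel` of (RBT-SDE) constructed in the tree, under H1–H2 with EQUAL growth exponents
`k₁ = k₂ = k ≥ 2` (the case the printed proof of §3.1 covers: with `k₁ < k₂` the single-time-scale
scaling argument of Theorem 3.3 does not apply — a rigidly pinned high-energy configuration
dissipates `o(E^{3/k₂-1/2})` in time `t_E` — and the repair of Cuneo–Eckmann–Hairer–Rey-Bellet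
2018 uses a state-dependent time scale outside the source), `γ, Λ > 0`, `N ≥ 2`, following the
printed proof of Theorem 3.10 (pp. 22–24) in the many-cells form of its second case
("split `[0, s]` into `E^{1/2-1/k}` pieces of size `E^{1/k-1/2}`", valid for every `k ≥ 2`) on a
DETERMINISTIC grid, exactly as in the tree's proof of CEHR Theorem 5.1 for Langevin baths
(`LangevinChainTheorem51.lean`):

* cells of length `τ ∈ [Λ₀ t_E, 2Λ₀ t_E]`, `Λ₀ = s/4`, `J = ⌊s/(Λ₀ t_E)⌋` of them; off the bad events
  (a grid energy `< E/2`, a grid energy `> 3E/2`, a large Brownian increment on a cell) every cell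
  dissipates `∫ r² ≥ ε₁ E^{3/k-1/2}` (`ReyBelletThomas2002Dissipation.lean`: the rescaled
  compactness argument of Thm 3.3/Cor 3.6 and the cell energy bound), so `Γ(s) ≥ 2γε₁E^{2/k}`;
* the exponential supermartingale bound (41) (`ReyBelletThomas2002ExpMartingale.lean`), the
  restart at grid times with (26), Chebyshev and Hölder at an exponent `pθ < 1/T_max`, and the
  Brownian oscillation tail (`BrownianSupTail.lean`) bound the pieces ((42));
* hence `T^s e^{θG}(x) ≤ ½ e^{θG(x)}` for `G(x) ≥ E₀` (`rb_lintegral_exp_rbEnergy_small`) and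
  Theorem 3.10 (`OscillatorChain.rb_thm310`), and — with Prop. 4.2 (`rb_irreducible`), Hörmander's
  theorem (`hormander1967_thm11_proof`) and the assembly `ReyBelletThomas2002_thm21_of_inputs_irreducible`
  — **Theorem 2.1 for `k₁ = k₂`** (`ReyBelletThomas2002_thm21_of_eq`).

## References

* L. Rey-Bellet, L. E. Thomas, Comm. Math. Phys. **225** (2002) 305–329, Thm 3.10 (pp. 22–24),
  eqs. (39)–(42); Thm 3.3, Cor 3.6, Prop 3.7; Thm 2.1.
* N. Cuneo, J.-P. Eckmann, M. Hairer, L. Rey-Bellet, EJP **23** (2018) no. 55, Thm 5.1, Cor 5.4,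
  Lemmas 5.5–5.6, Remark 3.? on the gap in [RBT02] (arXiv:1712.09413, §5).
-/

noncomputable section

open MeasureTheory ProbabilityTheory Filter Topology Set Metric Finset
open scoped NNReal ENNReal Topology

namespace Literature.MathematicalPhysics.KineticTheory.HeatConduction

open Literature.Probability.Process Literature.Analysis.ODE Literature.MathematicalPhysics.KineticTheory

variable {N : ℕ}

/-! ### The reservoir noise on good shifted paths -/

namespace OscillatorChain

variable (P : OscillatorChain)

/-- On a pair of continuous paths the reservoir noise is read off the paths:
`η(w)(t) = (√(2γT_L) (w_L(t⁺) - w_L(0)), √(2γT_R) (w_R(t⁺) - w_R(0)))`. [folklore] -/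
theorem rbEta_of_continuous (N : ℕ) (T_L T_R : ℝ) {w : WienerPair} (h1 : Continuous w.1)
    (h2 : Continuous w.2) (t : ℝ) :
    P.rbEta N T_L T_R w t = (Real.sqrt (2 * P.γ * T_L) * (w.1 t.toNNReal - w.1 0),
      Real.sqrt (2 * P.γ * T_R) * (w.2 t.toNNReal - w.2 0)) := by
  unfold rbEta
  rw [KineticTheory.pairNoise_of_continuous _ _ h1 h2]
  simp [rbNoiseVec, rbUnitRL_eq, rbUnitRR_eq]
  constructor <;> ring

/-- **On a good shifted pair the shifted reservoir noise is small**: if `θ_s ω ∈ goodPaths a h` then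
`‖η(θ_s ω)(u)‖ ≤ max(√(2γT_L), √(2γT_R)) a` for `u ∈ [0, h]`. [folklore] -/
theorem norm_rbEta_pairShift_le (N : ℕ) (T_L T_R : ℝ) {s : ℝ≥0} {a : ℝ} {h : ℝ≥0}
    {ω : WienerPair} (hω : pairShift s ω ∈ goodPaths a h) {u : ℝ} (hu0 : 0 ≤ u) (hu : u ≤ h) :
    ‖P.rbEta N T_L T_R (pairShift s ω) u‖ ≤
      max (Real.sqrt (2 * P.γ * T_L)) (Real.sqrt (2 * P.γ * T_R)) * a := by
  have hgood := abs_le_of_mem_goodPaths hω (continuous_pairShift_fst (s := s) ω)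
    (continuous_pairShift_snd (s := s) ω) (s := u.toNNReal)
    (by rw [← NNReal.coe_le_coe, Real.coe_toNNReal u hu0]; exact hu)
  rw [P.rbEta_of_continuous N T_L T_R (continuous_pairShift_fst (s := s) ω)
    (continuous_pairShift_snd (s := s) ω), pairShift_fst_zero, pairShift_snd_zero, sub_zero, sub_zero,
    Prod.norm_def]
  have hcL : 0 ≤ Real.sqrt (2 * P.γ * T_L) := Real.sqrt_nonneg _
  have hcR : 0 ≤ Real.sqrt (2 * P.γ * T_R) := Real.sqrt_nonneg _
  refine max_le ?_ ?_
  · rw [Real.norm_eq_abs, abs_mul, abs_of_nonneg hcL]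
    exact mul_le_mul (le_max_left _ _) hgood.1 (abs_nonneg _) (by positivity)
  · rw [Real.norm_eq_abs, abs_mul, abs_of_nonneg hcR]
    exact mul_le_mul (le_max_right _ _) hgood.2 (abs_nonneg _) (by positivity)

end OscillatorChain

/-! ### The dissipation along the grid -/

section Grid

variable {P : OscillatorChain} {k₁ k₂ : ℝ} (hU : RBGrowth P.U k₁) (hV : RBGrowth P.V k₂)
  (hk₁ : 1 ≤ k₁) (hk₂ : 1 ≤ k₂) (hγ : 0 ≤ P.γ) (Λ : ℝ) (N : ℕ) (T_L T_R : ℝ)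
include hU hV hk₁ hk₂ hγ

-- the flow is a limit of Picard iterations: never let the unifier unfold it (heartbeats)
attribute [local irreducible] OscillatorChain.rbFlow

/-- The driven flow on `[0, t]` only depends on the noise on `[0, t]`. [folklore] -/
theorem rbFlow_congr (x : RBPhaseSpace N) {η₁ η₂ : ℝ → ℝ × ℝ} (h₁ : Continuous η₁)
    (h₂ : Continuous η₂) {t : ℝ} (h : EqOn η₁ η₂ (Icc 0 t)) :
    EqOn (P.rbFlow Λ N x η₁) (P.rbFlow Λ N x η₂) (Icc 0 t) := by
  unfold OscillatorChain.rbFlow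
  exact (P.rbConfinedDrift hU hV hk₁ hk₂ hγ Λ N).flow_congr x (OscillatorChain.continuous_zero_prod h₁)
    (OscillatorChain.continuous_zero_prod h₂) (OscillatorChain.zero_prod_apply_mem_rbNoise η₁)
    (OscillatorChain.zero_prod_apply_mem_rbNoise η₂) fun s hs => by simp [h hs]

/-- The dissipation on `[0, t]` only depends on the noise on `[0, t]`. [folklore] -/
theorem rbDissipation_congr (x : RBPhaseSpace N) {η₁ η₂ : ℝ → ℝ × ℝ} (h₁ : Continuous η₁)
    (h₂ : Continuous η₂) {t : ℝ} (ht : 0 ≤ t) (h : EqOn η₁ η₂ (Icc 0 t)) :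
    P.rbDissipation Λ N x η₁ t = P.rbDissipation Λ N x η₂ t := by
  unfold OscillatorChain.rbDissipation
  congr 1
  refine intervalIntegral.integral_congr fun s hs => ?_
  rw [uIcc_of_le ht] at hs
  rw [rbFlow_congr hU hV hk₁ hk₂ hγ Λ N x h₁ h₂ h hs]

/-- **One step of the grid for the dissipation**: `Γ_{s+u}(x, η(B(ω))) = Γ_s(x, η(B(ω))) +
Γ_u(Φ_s(x, B(ω)), η(θ_s ω))`. [folklore] -/
theorem rbDissipation_pairShift (x : RBPhaseSpace N) (s : ℝ≥0) {u : ℝ} (hu : 0 ≤ u) (ω : WienerPair) :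
    P.rbDissipation Λ N x (P.rbEta N T_L T_R (pairPath ω)) (s + u) =
      P.rbDissipation Λ N x (P.rbEta N T_L T_R (pairPath ω)) s +
        P.rbDissipation Λ N (P.rbSolMap Λ N T_L T_R s x (pairPath ω))
          (P.rbEta N T_L T_R (pairShift s ω)) u := by
  have hηc : Continuous (P.rbEta N T_L T_R (pairPath ω)) := P.continuous_rbEta N T_L T_R _
  rw [OscillatorChain.rbDissipation_add hU hV hk₁ hk₂ hγ Λ N x hηc s.coe_nonneg hu, P.rbSolMap_eq_rbFlow]
  congr 1
  refine rbDissipation_congr hU hV hk₁ hk₂ hγ Λ N _ ?_ (P.continuous_rbEta N T_L T_R _) hu fun r hr => ?_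
  · exact (hηc.comp (continuous_const_add _)).sub continuous_const
  · exact (P.rbEta_pairShift N T_L T_R s ω hr.1).symm

/-- **The dissipation over `J` cells is the sum of the cell dissipations of the restarted flows**:
`Γ_{Jτ}(x, η(B(ω))) = ∑_{j<J} Γ_τ(Φ_{jτ}(x, B(ω)), η(θ_{jτ} ω))`. [folklore] -/
theorem rbDissipation_grid (x : RBPhaseSpace N) {τ : ℝ} (hτ : 0 ≤ τ) (ω : WienerPair) :
    ∀ J : ℕ, P.rbDissipation Λ N x (P.rbEta N T_L T_R (pairPath ω)) (J * τ) =
      ∑ j ∈ range J, P.rbDissipation Λ N (P.rbSolMap Λ N T_L T_R (j * τ) x (pairPath ω))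
        (P.rbEta N T_L T_R (pairShift ((j : ℝ) * τ).toNNReal ω)) τ
  | 0 => by simp
  | J + 1 => by
    have ih := rbDissipation_grid x hτ ω J
    have hJτ : (0 : ℝ) ≤ J * τ := by positivity
    rw [sum_range_succ, ← ih, Nat.cast_succ, add_mul, one_mul]
    have h := rbDissipation_pairShift hU hV hk₁ hk₂ hγ Λ N T_L T_R x ((J : ℝ) * τ).toNNReal hτ ω
    rwa [Real.coe_toNNReal _ hJτ] at h

end Grid

/-! ### (26) along the flow, restart, Chebyshev and Hölder for the constructed semigroup -/

section Estimates

variable {P : OscillatorChain} {k₁ k₂ : ℝ} (hU : RBGrowth P.U k₁) (hV : RBGrowth P.V k₂)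
  (hk₁ : 1 ≤ k₁) (hk₂ : 1 ≤ k₂) (hγ : 0 ≤ P.γ) (Λ : ℝ) (N : ℕ)
  {T_L T_R : ℝ} (hTL : 0 < T_L) (hTR : 0 < T_R) {θ : ℝ} (hθ : 0 < θ) (hθ' : θ < 1 / max T_L T_R)
include hU hV hk₁ hk₂ hγ hTL hTR hθ hθ'

/-- The exponential energy functional is measurable. [folklore] -/
theorem rb_measurable_exp_rbEnergy :
    Measurable fun y : RBPhaseSpace N => ENNReal.ofReal (Real.exp (θ * P.rbEnergy N y)) := by
  have := hγ; have := hTL; have := hTR; have := hθ; have := hθ'; have := hk₁; have := hk₂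
  exact ENNReal.measurable_ofReal.comp (Real.measurable_exp.comp
    ((P.contDiff_rbEnergy hU.1 hV.1 N).continuous.measurable.const_mul _))

/-- **(26) along the flow**: `E exp(θ G(Φ_t(x, B))) ≤ e^{γ(T_L+T_R)θ t} e^{θG(x)}`.
[cite: ReyBelletThomas2002, Lemma 3.5 eq. (26)] -/
theorem rb_lintegral_exp_rbEnergy_rbSolMap_le (t : ℝ≥0) (z : RBPhaseSpace N) :
    ∫⁻ ω, ENNReal.ofReal (Real.exp (θ * P.rbEnergy N (P.rbSolMap Λ N T_L T_R t z (pairPath ω)))) ∂wienerPair ≤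
      ENNReal.ofReal (Real.exp (P.γ * (T_L + T_R) * θ * t) * Real.exp (θ * P.rbEnergy N z)) := by
  have hmeas := rb_measurable_exp_rbEnergy hU hV hk₁ hk₂ hγ N hTL hTR hθ hθ'
  rw [← OscillatorChain.lintegral_rbKernel hU hV hk₁ hk₂ hγ Λ N T_L T_R t z hmeas]
  exact (P.rbSemigroup hU hV hk₁ hk₂ hγ Λ N T_L T_R hTL.le hTR.le).rb_h26 hU hV hk₁ hk₂ hγ hTL hTR θ hθ hθ' t z

/-- **Restart at a grid time** (the simple Markov property): for a measurable set `B` of states and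
`s, u ≥ 0`, `E[1_B(z_s) e^{θG(z_{s+u})}] ≤ e^{γ(T_L+T_R)θu} E[1_B(z_s) e^{θG(z_s)}]`.
[cite: ReyBelletThomas2002, Thm 3.10 (proof)] -/
theorem rb_lintegral_indicator_exp_rbEnergy_restart_le (s : ℝ≥0) {u : ℝ} (hu : 0 ≤ u)
    (x : RBPhaseSpace N) {B : Set (RBPhaseSpace N)} (hB : MeasurableSet B) :
    ∫⁻ ω, B.indicator 1 (P.rbSolMap Λ N T_L T_R s x (pairPath ω)) *
        ENNReal.ofReal (Real.exp (θ * P.rbEnergy N (P.rbSolMap Λ N T_L T_R (s + u) x (pairPath ω)))) ∂wienerPair ≤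
      ENNReal.ofReal (Real.exp (P.γ * (T_L + T_R) * θ * u)) *
        ∫⁻ ω, B.indicator 1 (P.rbSolMap Λ N T_L T_R s x (pairPath ω)) *
          ENNReal.ofReal (Real.exp (θ * P.rbEnergy N (P.rbSolMap Λ N T_L T_R s x (pairPath ω)))) ∂wienerPair := by
  have hVm := rb_measurable_exp_rbEnergy hU hV hk₁ hk₂ hγ N hTL hTR hθ hθ'
  set G : RBPhaseSpace N × WienerPair → ℝ≥0∞ := fun p => B.indicator 1 p.1 *
    ENNReal.ofReal (Real.exp (θ * P.rbEnergy N (P.rbSolMap Λ N T_L T_R u p.1 p.2))) with hG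
  have hGm : Measurable G := ((measurable_one.indicator hB).comp measurable_fst).mul
    (hVm.comp (measurable_rbSolMap hU hV hk₁ hk₂ hγ Λ N T_L T_R u))
  have hξ := measurable_comap_pairPast_rbSolMap hU hV hk₁ hk₂ hγ Λ N T_L T_R s x
  have hL : ∀ ω, B.indicator 1 (P.rbSolMap Λ N T_L T_R s x (pairPath ω)) *
      ENNReal.ofReal (Real.exp (θ * P.rbEnergy N (P.rbSolMap Λ N T_L T_R (s + u) x (pairPath ω)))) =
      G (P.rbSolMap Λ N T_L T_R s x (pairPath ω), pairShift s ω) := fun ω => by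
    rw [rbSolMap_add_pairPath hU hV hk₁ hk₂ hγ Λ N T_L T_R s hu x ω]
  simp_rw [hL]
  rw [lintegral_comp_pairShift_eq s hξ hGm]
  have hinner : ∀ ω, ∫⁻ ω', G (P.rbSolMap Λ N T_L T_R s x (pairPath ω), pairPath ω') ∂wienerPair ≤
      ENNReal.ofReal (Real.exp (P.γ * (T_L + T_R) * θ * u)) *
        (B.indicator 1 (P.rbSolMap Λ N T_L T_R s x (pairPath ω)) *
          ENNReal.ofReal (Real.exp (θ * P.rbEnergy N (P.rbSolMap Λ N T_L T_R s x (pairPath ω))))) := by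
    intro ω
    simp only [hG]
    have hm2 : Measurable fun ω' => ENNReal.ofReal (Real.exp (θ * P.rbEnergy N
        (P.rbSolMap Λ N T_L T_R u (P.rbSolMap Λ N T_L T_R s x (pairPath ω)) (pairPath ω')))) :=
      hVm.comp (OscillatorChain.measurable_rbSolMap_pairPath_right hU hV hk₁ hk₂ hγ Λ N T_L T_R u _)
    rw [lintegral_const_mul _ hm2]
    have h34 := rb_lintegral_exp_rbEnergy_rbSolMap_le hU hV hk₁ hk₂ hγ Λ N hTL hTR hθ hθ' u.toNNReal
      (P.rbSolMap Λ N T_L T_R s x (pairPath ω))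
    rw [Real.coe_toNNReal u hu] at h34
    calc B.indicator 1 (P.rbSolMap Λ N T_L T_R s x (pairPath ω)) *
          ∫⁻ ω', ENNReal.ofReal (Real.exp (θ * P.rbEnergy N
            (P.rbSolMap Λ N T_L T_R u (P.rbSolMap Λ N T_L T_R s x (pairPath ω)) (pairPath ω')))) ∂wienerPair
        ≤ B.indicator 1 (P.rbSolMap Λ N T_L T_R s x (pairPath ω)) *
          ENNReal.ofReal (Real.exp (P.γ * (T_L + T_R) * θ * u) *
            Real.exp (θ * P.rbEnergy N (P.rbSolMap Λ N T_L T_R s x (pairPath ω)))) := by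
          gcongr
      _ = _ := by
          rw [ENNReal.ofReal_mul (Real.exp_pos _).le]
          ring
  have hmeas : Measurable fun ω => B.indicator 1 (P.rbSolMap Λ N T_L T_R s x (pairPath ω)) *
      ENNReal.ofReal (Real.exp (θ * P.rbEnergy N (P.rbSolMap Λ N T_L T_R s x (pairPath ω)))) :=
    ((measurable_one.indicator hB).comp (OscillatorChain.measurable_rbSolMap_pairPath_right hU hV hk₁ hk₂ hγ Λ N T_L T_R s x)).mul
      (hVm.comp (OscillatorChain.measurable_rbSolMap_pairPath_right hU hV hk₁ hk₂ hγ Λ N T_L T_R s x))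
  calc ∫⁻ ω, ∫⁻ ω', G (P.rbSolMap Λ N T_L T_R s x (pairPath ω), pairPath ω') ∂wienerPair ∂wienerPair
      ≤ ∫⁻ ω, ENNReal.ofReal (Real.exp (P.γ * (T_L + T_R) * θ * u)) *
          (B.indicator 1 (P.rbSolMap Λ N T_L T_R s x (pairPath ω)) *
            ENNReal.ofReal (Real.exp (θ * P.rbEnergy N (P.rbSolMap Λ N T_L T_R s x (pairPath ω))))) ∂wienerPair :=
        lintegral_mono hinner
    _ = _ := lintegral_const_mul _ hmeas

/-- **Chebyshev for a grid energy**: `P(c < G(z_t)) ≤ e^{-θc} e^{γ(T_L+T_R)θt} e^{θG(x)}`.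
[cite: ReyBelletThomas2002, Remark 3.9 / Thm 3.10 (proof)] -/
theorem rb_measure_lt_rbEnergy_rbSolMap_le (t : ℝ≥0) (x : RBPhaseSpace N) (c : ℝ) :
    wienerPair {ω | c < P.rbEnergy N (P.rbSolMap Λ N T_L T_R t x (pairPath ω))} ≤
      ENNReal.ofReal (Real.exp (-(θ * c)) * (Real.exp (P.γ * (T_L + T_R) * θ * t) *
        Real.exp (θ * P.rbEnergy N x))) := by
  set f : WienerPair → ℝ≥0∞ := fun ω =>
    ENNReal.ofReal (Real.exp (θ * P.rbEnergy N (P.rbSolMap Λ N T_L T_R t x (pairPath ω)))) with hf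
  have hfm : Measurable f := (rb_measurable_exp_rbEnergy hU hV hk₁ hk₂ hγ N hTL hTR hθ hθ').comp
    (OscillatorChain.measurable_rbSolMap_pairPath_right hU hV hk₁ hk₂ hγ Λ N T_L T_R t x)
  have hsub : {ω | c < P.rbEnergy N (P.rbSolMap Λ N T_L T_R t x (pairPath ω))} ⊆
      {ω | ENNReal.ofReal (Real.exp (θ * c)) ≤ f ω} := by
    intro ω hω
    simp only [Set.mem_setOf_eq] at hω ⊢
    exact ENNReal.ofReal_le_ofReal (Real.exp_le_exp.2 (by nlinarith))
  refine (measure_mono hsub).trans ?_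
  have h1 := meas_ge_le_lintegral_div (μ := wienerPair) hfm.aemeasurable (ε := ENNReal.ofReal (Real.exp (θ * c)))
    (by simp [Real.exp_pos]) ENNReal.ofReal_ne_top
  refine h1.trans ?_
  rw [ENNReal.div_le_iff (by simp [Real.exp_pos]) ENNReal.ofReal_ne_top, ← ENNReal.ofReal_mul (by positivity)]
  refine (rb_lintegral_exp_rbEnergy_rbSolMap_le hU hV hk₁ hk₂ hγ Λ N hTL hTR hθ hθ' t x).trans (le_of_eq ?_)
  congr 1
  rw [Real.exp_neg]
  field_simp

omit hθ' in
/-- **Hölder with (26)** at an exponent `pθ < 1/T_max`: for `p > 1`, `q` the conjugate exponent and a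
measurable set `S` of paths, `E[e^{θG(z_t)}; S] ≤ e^{γ(T_L+T_R)θt} e^{θG(x)} P(S)^{1/q}`.
[cite: ReyBelletThomas2002, Thm 3.10 (proof, eqs. (41)–(42))] -/
theorem rb_lintegral_indicator_exp_rbEnergy_le_rpow {p : ℝ} (hp : 1 < p) (hpθ : p * θ < 1 / max T_L T_R)
    (t : ℝ≥0) (x : RBPhaseSpace N) {S : Set WienerPair} (hS : MeasurableSet S) :
    ∫⁻ ω, S.indicator 1 ω * ENNReal.ofReal (Real.exp (θ * P.rbEnergy N
        (P.rbSolMap Λ N T_L T_R t x (pairPath ω)))) ∂wienerPair ≤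
      ENNReal.ofReal (Real.exp (P.γ * (T_L + T_R) * θ * t) * Real.exp (θ * P.rbEnergy N x)) *
        wienerPair S ^ (1 / Real.conjExponent p) := by
  have hpq := Real.HolderConjugate.conjExponent hp
  set q := Real.conjExponent p with hq
  set f : WienerPair → ℝ≥0∞ := fun ω =>
    ENNReal.ofReal (Real.exp (θ * P.rbEnergy N (P.rbSolMap Λ N T_L T_R t x (pairPath ω)))) with hf
  have hp0 : 0 < p := by linarith
  have hfm : Measurable f :=
    (rb_measurable_exp_rbEnergy hU hV hk₁ hk₂ hγ N hTL hTR hθ (θ := θ)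
      (lt_of_le_of_lt (le_mul_of_one_le_left hθ.le hp.le) hpθ)).comp
      (OscillatorChain.measurable_rbSolMap_pairPath_right hU hV hk₁ hk₂ hγ Λ N T_L T_R t x)
  have hgm : Measurable (S.indicator (1 : WienerPair → ℝ≥0∞)) := measurable_one.indicator hS
  have hH := ENNReal.lintegral_mul_le_Lp_mul_Lq wienerPair hpq hfm.aemeasurable hgm.aemeasurable
  have hcomm : ∀ ω, S.indicator (1 : WienerPair → ℝ≥0∞) ω *
      ENNReal.ofReal (Real.exp (θ * P.rbEnergy N (P.rbSolMap Λ N T_L T_R t x (pairPath ω)))) =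
      (f * S.indicator (1 : WienerPair → ℝ≥0∞)) ω := fun ω => by
    simp only [Pi.mul_apply, hf]; rw [mul_comm]
  simp_rw [hcomm]
  refine hH.trans ?_
  have hfp : ∀ ω, f ω ^ p = ENNReal.ofReal (Real.exp ((p * θ) * P.rbEnergy N (P.rbSolMap Λ N T_L T_R t x (pairPath ω)))) := by
    intro ω
    simp only [hf]
    rw [ENNReal.ofReal_rpow_of_pos (Real.exp_pos _), ← Real.exp_mul]
    congr 2; ring
  have hmom : (∫⁻ ω, f ω ^ p ∂wienerPair) ^ (1 / p) ≤
      ENNReal.ofReal (Real.exp (P.γ * (T_L + T_R) * θ * t) * Real.exp (θ * P.rbEnergy N x)) := by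
    simp_rw [hfp]
    have h34 := rb_lintegral_exp_rbEnergy_rbSolMap_le hU hV hk₁ hk₂ hγ Λ N hTL hTR (θ := p * θ) (by positivity) hpθ t x
    calc (∫⁻ ω, ENNReal.ofReal (Real.exp ((p * θ) * P.rbEnergy N (P.rbSolMap Λ N T_L T_R t x (pairPath ω)))) ∂wienerPair) ^ (1 / p)
        ≤ (ENNReal.ofReal (Real.exp (P.γ * (T_L + T_R) * (p * θ) * t) * Real.exp (p * θ * P.rbEnergy N x))) ^ (1 / p) :=
          ENNReal.rpow_le_rpow h34 (by positivity)
      _ = _ := by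
          rw [ENNReal.ofReal_rpow_of_nonneg (by positivity) (by positivity), ← Real.exp_add, ← Real.exp_mul,
            ← Real.exp_add]
          congr 2
          field_simp
  have hind : ∫⁻ ω, S.indicator (1 : WienerPair → ℝ≥0∞) ω ^ q ∂wienerPair = wienerPair S := by
    have : ∀ ω, S.indicator (1 : WienerPair → ℝ≥0∞) ω ^ q = S.indicator 1 ω := fun ω => by
      by_cases hω : ω ∈ S
      · simp [hω]
      · simp [hω, ENNReal.zero_rpow_of_pos hpq.symm.pos]
    simp_rw [this]
    rw [lintegral_indicator_one hS]
  rw [hind]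
  gcongr

end Estimates

/-! ### Elementary asymptotics for the final bookkeeping -/

section Asymptotics

/-- `(c E + 1) e^{-κ E} → 0` as `E → ∞` (`c ≥ 0`, `κ > 0`). [folklore] -/
theorem tendsto_linear_mul_exp_neg {c κ : ℝ} (hc : 0 ≤ c) (hκ : 0 < κ) :
    Tendsto (fun E : ℝ => (c * E + 1) * Real.exp (-(κ * E))) atTop (𝓝 0) := by
  have h1 : Tendsto (fun E : ℝ => (κ * E) ^ 1 * Real.exp (-(κ * E))) atTop (𝓝 0) :=
    (Real.tendsto_pow_mul_exp_neg_atTop_nhds_zero 1).comp (tendsto_id.const_mul_atTop hκ)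
  have h2 : Tendsto (fun E : ℝ => (c + 1) / κ * ((κ * E) ^ 1 * Real.exp (-(κ * E)))) atTop (𝓝 0) := by
    simpa using h1.const_mul ((c + 1) / κ)
  refine tendsto_of_tendsto_of_tendsto_of_le_of_le' tendsto_const_nhds h2 ?_ ?_
  · filter_upwards [eventually_ge_atTop 0] with E hE
    exact mul_nonneg (by positivity) (Real.exp_pos _).le
  · filter_upwards [eventually_ge_atTop 1] with E hE
    have hlin : c * E + 1 ≤ (c + 1) * E := by nlinarith
    calc (c * E + 1) * Real.exp (-(κ * E)) ≤ ((c + 1) * E) * Real.exp (-(κ * E)) :=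
          mul_le_mul_of_nonneg_right hlin (Real.exp_pos _).le
      _ = (c + 1) / κ * ((κ * E) ^ 1 * Real.exp (-(κ * E))) := by
          field_simp

/-- `e^{-κ E^b} → 0` as `E → ∞` (`κ, b > 0`). [folklore] -/
theorem tendsto_exp_neg_mul_rpow {κ b : ℝ} (hκ : 0 < κ) (hb : 0 < b) :
    Tendsto (fun E : ℝ => Real.exp (-(κ * E ^ b))) atTop (𝓝 0) := by
  have h1 : Tendsto (fun E : ℝ => κ * E ^ b) atTop atTop := (tendsto_rpow_atTop hb).const_mul_atTop hκ
  exact Real.tendsto_exp_atBot.comp (tendsto_neg_atTop_atBot.comp h1)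

/-- `c E^{-b} → 0` as `E → ∞` (`b > 0`). [folklore] -/
theorem tendsto_const_mul_rpow_neg (c : ℝ) {b : ℝ} (hb : 0 < b) :
    Tendsto (fun E : ℝ => c * E ^ (-b)) atTop (𝓝 0) := by
  simpa using (tendsto_rpow_neg_atTop hb).const_mul c

end Asymptotics

/-! ### The dissipation over the whole grid on good paths (the "good paths" of p. 24) -/

section GridDissipation

variable {P : OscillatorChain} {k : ℝ} (hU : RBGrowth P.U k) (hV : RBGrowth P.V k)
  (hk1 : 1 ≤ k) (hγ : 0 ≤ P.γ) (Λ : ℝ) (N : ℕ) (T_L T_R : ℝ)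
include hU hV hk1 hγ

-- the flow is a limit of Picard iterations: never let the unifier unfold it (heartbeats)
attribute [local irreducible] OscillatorChain.rbFlow

/-- **Corollary 3.6 along the deterministic grid** ("for the good paths … applying Corollary 3.8
and using that `G(x(t_j)) = O(E)` we conclude that `∫₀ˢ r²` is at least of order
`E^{3/k-1/2} × (number of cells)`"): if every grid energy `G(z_{jτ})`, `j < J`, lies in
`[E/2, 3E/2]` and every Brownian increment over a cell is good, then
`Γ(Jτ) ≥ J · γ ε₁ E^{3/k-1/2}` — each cell satisfies the hypotheses of the cell dissipation bound
(`hF5`) thanks to the cell energy bound (`hcell`). [cite: ReyBelletThomas2002, Thm 3.10 (proof, p. 24)] -/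
theorem rb_grid_dissipation_ge {Λ₀ ε₁ δ₀ E₀ m₀ E₁ : ℝ}
    (hF5 : ∀ ⦃E : ℝ⦄, E₀ ≤ E → ∀ ⦃τ : ℝ⦄, Λ₀ * timeScale k E ≤ τ → τ ≤ 2 * Λ₀ * timeScale k E →
      ∀ x : RBPhaseSpace N, E / 2 ≤ P.rbEnergy N x →
        ∀ ⦃η : ℝ → ℝ × ℝ⦄, Continuous η → η 0 = 0 → (∀ s ∈ Icc 0 τ, ‖η s‖ ≤ δ₀ * E ^ (1 / k)) →
          (∀ s ∈ Icc 0 τ, P.rbEnergy N (P.rbFlow Λ N x η s) ≤ 4 * E) →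
            ε₁ * E ^ (3 / k - 1 / 2) ≤
              ∫ s in (0 : ℝ)..τ, ((P.rbFlow Λ N x η s).2.1 ^ 2 + (P.rbFlow Λ N x η s).2.2 ^ 2))
    (hcell : ∀ ⦃E : ℝ⦄, E₁ ≤ E → ∀ ⦃τ : ℝ⦄, 0 ≤ τ → τ ≤ 2 * Λ₀ * timeScale k E →
      ∀ x : RBPhaseSpace N, P.rbEnergy N x ≤ 3 * E / 2 →
        ∀ ⦃η : ℝ → ℝ × ℝ⦄, Continuous η → (∀ s ∈ Icc 0 τ, ‖η s‖ ≤ m₀ * E ^ (1 / k)) →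
          ∀ s ∈ Icc 0 τ, P.rbEnergy N (P.rbFlow Λ N x η s) ≤ 2 * E)
    {E τ m' : ℝ} (hE0 : E₀ ≤ E) (hE1 : E₁ ≤ E) (hE : 0 ≤ E) (hτ0 : 0 ≤ τ)
    (hτ1 : Λ₀ * timeScale k E ≤ τ) (hτ2 : τ ≤ 2 * Λ₀ * timeScale k E)
    (hnoise : max (Real.sqrt (2 * P.γ * T_L)) (Real.sqrt (2 * P.γ * T_R)) * m' ≤ m₀ * E ^ (1 / k))
    (hnoise2 : m₀ * E ^ (1 / k) ≤ δ₀ * E ^ (1 / k)) (x : RBPhaseSpace N) (J : ℕ) (ω : WienerPair)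
    (hgrid : ∀ j : ℕ, j < J → E / 2 ≤ P.rbEnergy N (P.rbSolMap Λ N T_L T_R (j * τ) x (pairPath ω)) ∧
      P.rbEnergy N (P.rbSolMap Λ N T_L T_R (j * τ) x (pairPath ω)) ≤ 3 * E / 2)
    (hgood : ∀ j : ℕ, j < J → pairShift ((j : ℝ) * τ).toNNReal ω ∈ goodPaths m' τ.toNNReal) :
    (J : ℝ) * (P.γ * (ε₁ * E ^ (3 / k - 1 / 2))) ≤
      P.rbDissipation Λ N x (P.rbEta N T_L T_R (pairPath ω)) (J * τ) := by
  rw [rbDissipation_grid hU hV hk1 hk1 hγ Λ N T_L T_R x hτ0 ω J]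
  have hcellJ : ∀ j ∈ range J, P.γ * (ε₁ * E ^ (3 / k - 1 / 2)) ≤
      P.rbDissipation Λ N (P.rbSolMap Λ N T_L T_R (j * τ) x (pairPath ω))
        (P.rbEta N T_L T_R (pairShift ((j : ℝ) * τ).toNNReal ω)) τ := by
    intro j hj
    have hj' := mem_range.1 hj
    obtain ⟨hg1, hg2⟩ := hgrid j hj'
    set z := P.rbSolMap Λ N T_L T_R (j * τ) x (pairPath ω) with hz
    set η := P.rbEta N T_L T_R (pairShift ((j : ℝ) * τ).toNNReal ω) with hη
    have hηc : Continuous η := P.continuous_rbEta N T_L T_R _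
    have hη0 : η 0 = 0 := by
      rw [hη, P.rbEta_of_continuous N T_L T_R (continuous_pairShift_fst (s := ((j : ℝ) * τ).toNNReal) ω)
        (continuous_pairShift_snd (s := ((j : ℝ) * τ).toNNReal) ω)]
      simp
    have hηb : ∀ s ∈ Icc 0 τ, ‖η s‖ ≤ m₀ * E ^ (1 / k) := fun s hs => by
      have h := P.norm_rbEta_pairShift_le N T_L T_R (hgood j hj') hs.1
        (by rw [Real.coe_toNNReal']; exact le_max_of_le_left hs.2)
      exact h.trans hnoise
    have hηb' : ∀ s ∈ Icc 0 τ, ‖η s‖ ≤ δ₀ * E ^ (1 / k) := fun s hs => (hηb s hs).trans hnoise2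
    have hEc : ∀ s ∈ Icc 0 τ, P.rbEnergy N (P.rbFlow Λ N z η s) ≤ 4 * E := fun s hs => by
      have := hcell hE1 hτ0 hτ2 z hg2 hηc hηb s hs
      linarith only [this, hE]
    have h5 := hF5 hE0 hτ1 hτ2 z hg1 hηc hη0 hηb' hEc
    show P.γ * (ε₁ * E ^ (3 / k - 1 / 2)) ≤
      P.γ * ∫ s in (0:ℝ)..τ, ((P.rbFlow Λ N z η s).2.1 ^ 2 + (P.rbFlow Λ N z η s).2.2 ^ 2)
    exact mul_le_mul_of_nonneg_left h5 hγ
  have h := Finset.card_nsmul_le_sum (range J) _ _ hcellJ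
  rwa [card_range, nsmul_eq_mul] at h

end GridDissipation

/-! ### The high-energy estimate: `E_x e^{θG(x(s)) - θG(x)} → 0` ((42), many-cells form) -/

section Main

variable {P : OscillatorChain} {k : ℝ} (hU : RBGrowth P.U k) (hV : RBGrowth P.V k) (hk : 2 ≤ k)
  (hγ : 0 < P.γ) {Λ : ℝ} (hΛ : Λ ≠ 0) (hN : 0 < N) {T_L T_R : ℝ} (hTL : 0 < T_L) (hTR : 0 < T_R)
  {θ : ℝ} (hθ : 0 < θ) (hθ' : θ < 1 / max T_L T_R)
include hU hV hk hγ hΛ hN hTL hTR hθ hθ'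

-- the flow is a limit of Picard iterations: never let the unifier unfold it (heartbeats)
attribute [local irreducible] OscillatorChain.rbFlow

/-- **Theorem 3.10, qualitative high-energy form** (`k₁ = k₂ = k ≥ 2`, `γ > 0`, `Λ ≠ 0`, `N ≥ 1`,
`T_L, T_R > 0`, `0 < θ < 1/T_max`, `s > 0`): there is `E₀` such that for every start `x` with
`G(x) ≥ E₀`, `E_x e^{θG(x(s))} ≤ ½ e^{θG(x)}` ((42): "choosing … `E₁` large enough we can make the
term in Eq. (42) as small as we want"). Proof: the grid decomposition described in the module
docstring. [cite: ReyBelletThomas2002, Thm 3.10 eqs. (41)–(42)] -/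
theorem rb_lintegral_exp_rbEnergy_small {tstar : ℝ} (hts : 0 < tstar) :
    ∃ E₀ : ℝ, ∀ x : RBPhaseSpace N, E₀ ≤ P.rbEnergy N x →
      ∫⁻ ω, ENNReal.ofReal (Real.exp (θ * P.rbEnergy N
          (P.rbSolMap Λ N T_L T_R tstar x (pairPath ω)))) ∂wienerPair ≤
        ENNReal.ofReal (Real.exp (θ * P.rbEnergy N x) / 2) := by
  have hk1 : 1 ≤ k := by linarith
  have hk0 : 0 < k := by linarith
  have hγ0 : 0 ≤ P.γ := hγ.le
  have hTm : 0 < max T_L T_R := lt_max_of_lt_left hTL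
  have hθT : θ * max T_L T_R < 1 := (lt_div_iff₀ hTm).1 hθ'
  -- constants of the estimate
  set κ : ℝ := θ * (1 - θ * max T_L T_R) with hκ
  have hκ0 : 0 < κ := mul_pos hθ (by linarith only [hθT])
  set Cst : ℝ := P.γ * (T_L + T_R) * θ with hCst
  have hCst0 : 0 ≤ Cst := by positivity
  -- the Hölder exponent: `1 < p`, `pθ < 1/T_max`
  set p : ℝ := (1 + 1 / (θ * max T_L T_R)) / 2 with hp
  have hθT0 : 0 < θ * max T_L T_R := by positivity
  have hp1 : 1 < p := by
    rw [hp]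
    have : 1 < 1 / (θ * max T_L T_R) := by rw [lt_div_iff₀ hθT0]; linarith only [hθT]
    linarith only [this]
  have hpθ : p * θ < 1 / max T_L T_R := by
    rw [lt_div_iff₀ hTm, hp]
    have h1 : (1 + 1 / (θ * max T_L T_R)) / 2 * θ * max T_L T_R = (θ * max T_L T_R + 1) / 2 := by
      field_simp
    calc (1 + 1 / (θ * max T_L T_R)) / 2 * θ * max T_L T_R = (θ * max T_L T_R + 1) / 2 := h1
      _ < 1 := by linarith only [hθT]
  have hpq := Real.HolderConjugate.conjExponent hp1
  set q := Real.conjExponent p with hq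
  have hq0 : 0 < 1 / q := by have := hpq.symm.pos; positivity
  -- the macroscopic cell length `Λ₀ = s/4` and the deterministic inputs
  set Λ₀ : ℝ := tstar / 4 with hΛ₀
  have hΛ₀0 : 0 < Λ₀ := by positivity
  obtain ⟨E₀, δ₀, ε₁, hE₀1, hδ₀, hε₁, hF5⟩ :=
    OscillatorChain.rb_cell_dissipation_ge hU hV hk hγ0 hΛ hN hΛ₀0
  obtain ⟨m₀, E₁, hm₀, -, hE₁1, hcell⟩ := OscillatorChain.rb_cell_energy_le hU hV hk hγ0 Λ hΛ₀0 (N := N)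
  -- a common noise threshold `m₀' = min m₀ δ₀`
  set m₀' : ℝ := min m₀ δ₀ with hm₀'
  have hm₀'0 : 0 < m₀' := lt_min hm₀ hδ₀
  have hcell' : ∀ ⦃E : ℝ⦄, E₁ ≤ E → ∀ ⦃τ : ℝ⦄, 0 ≤ τ → τ ≤ 2 * Λ₀ * timeScale k E →
      ∀ x : RBPhaseSpace N, P.rbEnergy N x ≤ 3 * E / 2 →
        ∀ ⦃η : ℝ → ℝ × ℝ⦄, Continuous η → (∀ s ∈ Icc 0 τ, ‖η s‖ ≤ m₀' * E ^ (1 / k)) →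
          ∀ s ∈ Icc 0 τ, P.rbEnergy N (P.rbFlow Λ N x η s) ≤ 2 * E := by
    intro E hE τ hτ0 hτ x hx η hηc hηb
    have hE0 : 0 ≤ E := by linarith
    exact hcell hE hτ0 hτ x hx hηc fun s hs => (hηb s hs).trans
      (mul_le_mul_of_nonneg_right (min_le_left _ _) (Real.rpow_nonneg hE0 _))
  set cmax : ℝ := max (Real.sqrt (2 * P.γ * T_L)) (Real.sqrt (2 * P.γ * T_R)) with hcmax
  have hcmax0 : 0 ≤ cmax := le_max_of_le_left (Real.sqrt_nonneg _)
  set m₁ : ℝ := m₀' / (cmax + 1) with hm₁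
  have hm₁0 : 0 < m₁ := by positivity
  have hm₁le : cmax * m₁ ≤ m₀' := by
    rw [hm₁, mul_div_assoc']
    rw [div_le_iff₀ (by positivity)]
    nlinarith only [hcmax0, hm₀'0]
  -- the bound function and its decay
  set C₂ : ℝ := 256 * Λ₀ ^ 2 / m₁ ^ 4 with hC₂
  set Bf : ℝ → ℝ := fun E => Real.exp (Cst * tstar) * Real.exp (-(2 * κ * P.γ * ε₁ * E ^ (2 / k))) +
      (4 * E + 1) * Real.exp (Cst * tstar) * Real.exp (-(θ / 2 * E)) +
      Real.exp (Cst * tstar) * ((4 * E + 1) * Real.exp (Cst * tstar) * Real.exp (-(θ / 2 * E)) +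
        C₂ * E ^ (-(2 / k))) ^ (1 / q) with hBf
  have hBf0 : Tendsto Bf atTop (𝓝 0) := by
    have h1 : Tendsto (fun E : ℝ => Real.exp (Cst * tstar) * Real.exp (-(2 * κ * P.γ * ε₁ * E ^ (2 / k))))
        atTop (𝓝 0) := by
      have := (tendsto_exp_neg_mul_rpow (κ := 2 * κ * P.γ * ε₁) (b := 2 / k) (by positivity)
        (by positivity)).const_mul (Real.exp (Cst * tstar))
      simpa using this
    have h2 : Tendsto (fun E : ℝ => (4 * E + 1) * Real.exp (Cst * tstar) * Real.exp (-(θ / 2 * E))) atTop (𝓝 0) := by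
      have := (tendsto_linear_mul_exp_neg (c := 4) (by norm_num) (κ := θ / 2) (by positivity)).const_mul
        (Real.exp (Cst * tstar))
      rw [mul_zero] at this
      refine this.congr fun E => ?_
      ring
    have h3 : Tendsto (fun E : ℝ => C₂ * E ^ (-(2 / k))) atTop (𝓝 0) :=
      tendsto_const_mul_rpow_neg _ (by positivity)
    have h4 := ((h2.add h3).rpow_const (Or.inr hq0.le)).const_mul (Real.exp (Cst * tstar))
    rw [add_zero, Real.zero_rpow hq0.ne', mul_zero] at h4
    have := (h1.add h2).add h4
    simpa only [add_zero] using this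
  -- thresholds
  have hb1 : 0 < 1 / 2 + 1 / k := by positivity
  have hsm : Tendsto (fun E : ℝ => tstar * E ^ (-(1 / 2 + 1 / k))) atTop (𝓝 0) :=
    tendsto_const_mul_rpow_neg _ hb1
  have hev : ∀ᶠ E : ℝ in atTop, Bf E < 1 / 2 ∧ max E₀ E₁ ≤ E ∧ 1 ≤ E ∧
      tstar * E ^ (-(1 / 2 + 1 / k)) < m₁ ^ 2 := by
    refine ((tendsto_order.1 hBf0).2 _ (by norm_num)).and ((eventually_ge_atTop _).and
      ((eventually_ge_atTop _).and (hsm.eventually_lt_const (by positivity))))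
  obtain ⟨A, hA⟩ := Filter.eventually_atTop.1 hev
  set A' : ℝ := max A 1 with hA'
  refine ⟨A', fun x hx => ?_⟩
  ----------------------------------------------------------------
  -- Step 1: the energy `E = G(x)`, the time scale and the grid
  ----------------------------------------------------------------
  set E : ℝ := P.rbEnergy N x with hE
  obtain ⟨hBa, hmaxE, hE1, hsmall⟩ := hA E ((le_max_left _ _).trans hx)
  have hE0 : 0 < E := by linarith only [hE1]
  have hEE₀ : E₀ ≤ E := (le_max_left _ _).trans hmaxE
  have hEE₁ : E₁ ≤ E := (le_max_right _ _).trans hmaxE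
  set tE : ℝ := timeScale k E with htE
  have htE0 : 0 < tE := timeScale_pos k hE0
  have htE1 : tE ≤ 1 := rpow_inv_sub_half_le_one hU hV hk hE1
  -- the grid: `r = s/(Λ₀ t_E) = 4/t_E ≥ 4`, `J = ⌊r⌋`, `τ = s/J ∈ [Λ₀ t_E, 2Λ₀ t_E]`, `Jτ = s`
  set r : ℝ := tstar / (Λ₀ * tE) with hr
  have hr4 : r = 4 / tE := by rw [hr, hΛ₀]; field_simp
  have hr2 : 4 ≤ r := by
    rw [hr4, le_div_iff₀ htE0]; linarith only [htE1]
  set J : ℕ := ⌊r⌋₊ with hJ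
  have hJle : (J : ℝ) ≤ r := Nat.floor_le (by linarith only [hr2])
  have hJlt : r < J + 1 := Nat.lt_floor_add_one r
  have hJ1 : (1 : ℝ) ≤ J := by
    have : (1 : ℝ) < J := by linarith only [hr2, hJlt]
    exact this.le
  have hJpos : (0 : ℝ) < J := by linarith only [hJ1]
  have hJne : (J : ℝ) ≠ 0 := hJpos.ne'
  set τ : ℝ := tstar / J with hτ
  have hτ0 : 0 < τ := div_pos hts hJpos
  have hJτ : (J : ℝ) * τ = tstar := by rw [hτ]; field_simp
  have hτ1 : Λ₀ * tE ≤ τ := by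
    rw [hτ, le_div_iff₀ hJpos]
    have : (J : ℝ) * (Λ₀ * tE) ≤ tstar := by
      have := hJle; rw [hr, le_div_iff₀ (by positivity)] at this; linarith only [this]
    linarith only [this]
  have hτ2 : τ ≤ 2 * Λ₀ * tE := by
    rw [hτ, div_le_iff₀ hJpos]
    have h2J : r ≤ 2 * J := by linarith only [hJlt, hJ1, hr2]
    rw [hr, div_le_iff₀ (by positivity)] at h2J
    linarith only [h2J]
  have hτt : τ ≤ tstar := by
    rw [hτ, div_le_iff₀ hJpos]; nlinarith only [hJ1, hts.le]
  have hjτ : ∀ j : ℕ, j < J + 1 → (j : ℝ) * τ ≤ tstar := fun j hj => by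
    have : (j : ℝ) ≤ J := by exact_mod_cast Nat.lt_succ_iff.1 hj
    calc (j : ℝ) * τ ≤ J * τ := mul_le_mul_of_nonneg_right this hτ0.le
      _ = tstar := hJτ
  -- `J ≤ 4E` (`J ≤ 4/t_E = 4 E^{1/2-1/k} ≤ 4E`) and `J ≥ 2/t_E`
  have hk' : (0 : ℝ) < 1 / k := by positivity
  have htEE : 1 ≤ E * tE := by
    have hne : 1 + (1 / k - 1 / 2) ≠ 0 := by intro h; linarith only [h, hk']
    rw [htE, timeScale, ← Real.rpow_one_add' hE0.le hne]
    exact Real.one_le_rpow hE1 (by linarith only [hk'])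
  have hJr : (J : ℝ) ≤ 4 * E := by
    refine hJle.trans ?_
    rw [hr4, div_le_iff₀ htE0]
    nlinarith only [htEE]
  have hJlow : 2 / tE ≤ J := by
    have h1 : r - 1 ≤ J := by linarith only [hJlt]
    rw [hr4] at h1
    have h2 : 2 ≤ 2 / tE := by rw [le_div_iff₀ htE0]; linarith only [htE1]
    have : 4 / tE = 2 / tE + 2 / tE := by ring
    linarith only [h1, h2, this]
  -- small-noise thresholds
  set m' : ℝ := m₁ * E ^ (1 / k) with hm'
  have hEk0 : 0 < E ^ (1 / k) := Real.rpow_pos_of_pos hE0 _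
  have hm'0 : 0 ≤ m' := by positivity
  have hnoise : cmax * m' ≤ m₀' * E ^ (1 / k) := by
    rw [hm', ← mul_assoc]; exact mul_le_mul_of_nonneg_right hm₁le hEk0.le
  have hnoise2 : m₀' * E ^ (1 / k) ≤ δ₀ * E ^ (1 / k) :=
    mul_le_mul_of_nonneg_right (min_le_right _ _) hEk0.le
  have hτsmall : τ ≤ m' ^ 2 / 2 := by
    refine hτ2.trans ?_
    -- `2 Λ₀ t_E = (s/2) E^{1/k-1/2} ≤ m₁² E^{2/k} / 2` iff `s E^{-1/2-1/k} ≤ m₁²`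
    have h1 : tstar * E ^ (-(1 / 2 + 1 / k)) * E ^ (2 / k) = tstar * tE := by
      show tstar * E ^ (-(1 / 2 + 1 / k)) * E ^ (2 / k) = tstar * timeScale k E
      rw [timeScale, mul_assoc, ← Real.rpow_add hE0]
      congr 2; ring
    have h2 : m' ^ 2 = m₁ ^ 2 * E ^ (2 / k) := by
      rw [hm', mul_pow]
      congr 1
      rw [← Real.rpow_natCast, ← Real.rpow_mul hE0.le]
      congr 1; push_cast; ring
    have h3 : tstar * tE ≤ m₁ ^ 2 * E ^ (2 / k) := by
      rw [← h1]
      exact mul_le_mul_of_nonneg_right hsmall.le (Real.rpow_nonneg hE0.le _)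
    rw [h2, hΛ₀]
    linarith only [h3]
  ----------------------------------------------------------------
  -- Step 2: the events
  ----------------------------------------------------------------
  set G := P.rbEnergy N with hG
  have hGm : Measurable G := (P.contDiff_rbEnergy hU.1 hV.1 N).continuous.measurable
  have hsolm : ∀ t : ℝ, Measurable fun ω : WienerPair => P.rbSolMap Λ N T_L T_R t x (pairPath ω) :=
    fun t => OscillatorChain.measurable_rbSolMap_pairPath_right hU hV hk1 hk1 hγ0 Λ N T_L T_R t x
  set z : ℕ → WienerPair → RBPhaseSpace N := fun j ω => P.rbSolMap Λ N T_L T_R (j * τ) x (pairPath ω) with hz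
  have hzm : ∀ j, Measurable (z j) := fun j => hsolm _
  set F : WienerPair → ℝ≥0∞ := fun ω =>
    ENNReal.ofReal (Real.exp (θ * G (P.rbSolMap Λ N T_L T_R tstar x (pairPath ω)))) with hF
  have hFm : Measurable F := ENNReal.measurable_ofReal.comp (Real.measurable_exp.comp
    ((hGm.comp (hsolm tstar)).const_mul _))
  set Γ : WienerPair → ℝ := fun ω => P.rbDissipation Λ N x (P.rbEta N T_L T_R (pairPath ω)) tstar with hΓ
  have hΓm : Measurable Γ := rb_measurable_dissipation_pairPath hU hV hk1 hk1 hγ0 Λ N tstar x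
  set g : ℝ := 2 * P.γ * ε₁ * E ^ (2 / k) with hg
  set SΓ : Set WienerPair := {ω | g ≤ Γ ω} with hSΓ
  have hSΓm : MeasurableSet SΓ := measurableSet_le measurable_const hΓm
  set D : ℕ → Set WienerPair := fun j => {ω | G (z j ω) < E / 2} with hD
  have hDm : ∀ j, MeasurableSet (D j) := fun j => measurableSet_lt (hGm.comp (hzm j)) measurable_const
  set U : ℕ → Set WienerPair := fun j => {ω | 3 * E / 2 < G (z j ω)} with hUdef
  have hUm : ∀ j, MeasurableSet (U j) := fun j => measurableSet_lt measurable_const (hGm.comp (hzm j))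
  set Nb : ℕ → Set WienerPair := fun j =>
    {ω | pairShift ((j : ℝ) * τ).toNNReal ω ∉ goodPaths m' τ.toNNReal} with hNb
  have hNbm : ∀ j, MeasurableSet (Nb j) := fun j =>
    ((measurable_pairShift (s := ((j : ℝ) * τ).toNNReal)) (measurableSet_goodPaths m' τ.toNNReal)).compl
  set S₃ : Set WienerPair := (⋃ j ∈ range (J + 1), U j) ∪ (⋃ j ∈ range J, Nb j) with hS₃
  have hS₃m : MeasurableSet S₃ := (Finset.measurableSet_biUnion _ fun j _ => hUm j).union
    (Finset.measurableSet_biUnion _ fun j _ => hNbm j)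
  ----------------------------------------------------------------
  -- Step 3: off `S₃` and the `D_j`, the dissipation is at least `g` (sure)
  ----------------------------------------------------------------
  have hcover : ∀ ω, ω ∉ S₃ → (∀ j ∈ range (J + 1), ω ∉ D j) → ω ∈ SΓ := by
    intro ω h3 hD'
    simp only [hS₃, Set.mem_union, Set.mem_iUnion, not_or, not_exists, exists_prop, not_and] at h3
    obtain ⟨hU', hNb'⟩ := h3
    have hgrid : ∀ j : ℕ, j < J → E / 2 ≤ P.rbEnergy N (P.rbSolMap Λ N T_L T_R (j * τ) x (pairPath ω)) ∧
        P.rbEnergy N (P.rbSolMap Λ N T_L T_R (j * τ) x (pairPath ω)) ≤ 3 * E / 2 := by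
      intro j hj
      have hj' : j ∈ range (J + 1) := mem_range.2 (by omega)
      have h1 := hD' j hj'
      have h2 := hU' j hj'
      simp only [hD, hUdef, hz, Set.mem_setOf_eq, not_lt] at h1 h2
      exact ⟨h1, h2⟩
    have hgood : ∀ j : ℕ, j < J → pairShift ((j : ℝ) * τ).toNNReal ω ∈ goodPaths m' τ.toNNReal := by
      intro j hj
      have := hNb' j (mem_range.2 hj)
      simpa only [hNb, Set.mem_setOf_eq, not_not] using this
    have hdis := rb_grid_dissipation_ge hU hV hk1 hγ0 Λ N T_L T_R hF5 hcell' hEE₀ hEE₁ hE0.le hτ0.le hτ1 hτ2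
      hnoise hnoise2 x J ω hgrid hgood
    rw [hJτ] at hdis
    show g ≤ Γ ω
    refine le_trans ?_ hdis
    -- `g = 2γε₁E^{2/k} ≤ J γ ε₁ E^{3/k-1/2}` since `J ≥ 2/t_E = 2E^{1/2-1/k}`
    have hpow : (2 / tE) * E ^ (3 / k - 1 / 2) = 2 * E ^ (2 / k) := by
      rw [htE, timeScale, div_mul_eq_mul_div, div_eq_iff (Real.rpow_pos_of_pos hE0 _).ne', mul_assoc,
        ← Real.rpow_add hE0]
      congr 2; ring
    have h0 : 0 ≤ P.γ * (ε₁ * E ^ (3 / k - 1 / 2)) := by positivity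
    calc g = (2 / tE) * (P.γ * (ε₁ * E ^ (3 / k - 1 / 2))) := by
          rw [hg]
          have : (2 / tE) * (P.γ * (ε₁ * E ^ (3 / k - 1 / 2))) = P.γ * ε₁ * ((2 / tE) * E ^ (3 / k - 1 / 2)) := by
            ring
          rw [this, hpow]; ring
      _ ≤ (J : ℝ) * (P.γ * (ε₁ * E ^ (3 / k - 1 / 2))) := mul_le_mul_of_nonneg_right hJlow h0
  -- pointwise domination of `F`
  have hdom : ∀ ω, F ω ≤ SΓ.indicator F ω + (∑ j ∈ range (J + 1), (D j).indicator F ω) + S₃.indicator F ω := by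
    intro ω
    by_cases h3 : ω ∈ S₃
    · rw [Set.indicator_of_mem h3]
      exact le_add_self
    · by_cases hD' : ∃ j ∈ range (J + 1), ω ∈ D j
      · obtain ⟨j, hj, hωj⟩ := hD'
        have : F ω ≤ ∑ j ∈ range (J + 1), (D j).indicator F ω := by
          calc F ω = (D j).indicator F ω := (Set.indicator_of_mem hωj F).symm
            _ ≤ ∑ j ∈ range (J + 1), (D j).indicator F ω :=
                Finset.single_le_sum (f := fun j => (D j).indicator F ω) (fun _ _ => bot_le) hj
        exact this.trans (le_add_left le_rfl |>.trans (le_add_right le_rfl))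
      · push Not at hD'
        rw [Set.indicator_of_mem (hcover ω h3 hD')]
        exact le_add_right (le_add_right le_rfl)
  ----------------------------------------------------------------
  -- Step 4: the three integral bounds
  ----------------------------------------------------------------
  -- (T1) large dissipation: the exponential supermartingale ((41))
  have hT1 : ∫⁻ ω, SΓ.indicator F ω ∂wienerPair ≤
      ENNReal.ofReal (Real.exp (-(κ * g)) * Real.exp (θ * E + Cst * tstar)) := by
    have hpt : ∀ ω, SΓ.indicator F ω ≤ ENNReal.ofReal (Real.exp (-(κ * g))) *
        ENNReal.ofReal (Real.exp (θ * G (P.rbSolMap Λ N T_L T_R tstar x (pairPath ω)) + κ * Γ ω)) := by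
      intro ω
      by_cases hω : ω ∈ SΓ
      · rw [Set.indicator_of_mem hω, hF, ← ENNReal.ofReal_mul (Real.exp_pos _).le, ← Real.exp_add]
        refine ENNReal.ofReal_le_ofReal (Real.exp_le_exp.2 ?_)
        have : g ≤ Γ ω := hω
        nlinarith only [this, hκ0]
      · rw [Set.indicator_of_notMem hω]; exact bot_le
    refine (lintegral_mono hpt).trans ?_
    have hm2 : Measurable fun ω => ENNReal.ofReal (Real.exp (θ * G (P.rbSolMap Λ N T_L T_R tstar x (pairPath ω)) + κ * Γ ω)) :=
      ENNReal.measurable_ofReal.comp (Real.measurable_exp.comp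
        (((hGm.comp (hsolm tstar)).const_mul _).add (hΓm.const_mul _)))
    rw [lintegral_const_mul _ hm2, ENNReal.ofReal_mul (Real.exp_pos _).le]
    gcongr
    have h := rb_lintegral_exp_rbEnergy_add_dissipation_le hU hV hk1 hk1 hγ0 Λ N hTL.le hTR.le θ hts.le x
    have he : Real.exp (θ * P.rbEnergy N x + θ * P.γ * (T_L + T_R) * tstar) = Real.exp (θ * E + Cst * tstar) := by
      congr 1; rw [hCst]; ring
    rw [he] at h
    simpa only [hκ] using h
  -- (T2) low grid energy: restart and (26)
  have hT2 : ∀ j ∈ range (J + 1), ∫⁻ ω, (D j).indicator F ω ∂wienerPair ≤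
      ENNReal.ofReal (Real.exp (Cst * tstar) * Real.exp (θ * E / 2)) := by
    intro j hj
    have hj' := mem_range.1 hj
    set B : Set (RBPhaseSpace N) := {y | G y < E / 2} with hB
    have hBm : MeasurableSet B := measurableSet_lt hGm measurable_const
    have hind : ∀ ω, (D j).indicator F ω = B.indicator 1 (z j ω) * F ω := fun ω => by
      by_cases hω : ω ∈ D j
      · have : z j ω ∈ B := hω
        rw [Set.indicator_of_mem hω, Set.indicator_of_mem this, Pi.one_apply, one_mul]
      · have : z j ω ∉ B := hω
        rw [Set.indicator_of_notMem hω, Set.indicator_of_notMem this, zero_mul]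
    simp_rw [hind]
    have hu : 0 ≤ tstar - j * τ := by linarith only [hjτ j hj']
    have hsj : (((j : ℝ) * τ).toNNReal : ℝ) = j * τ := Real.coe_toNNReal _ (by positivity)
    have hR := rb_lintegral_indicator_exp_rbEnergy_restart_le hU hV hk1 hk1 hγ0 Λ N hTL hTR hθ hθ'
      ((j : ℝ) * τ).toNNReal hu x hBm
    rw [hsj, show (j : ℝ) * τ + (tstar - j * τ) = tstar by ring] at hR
    refine hR.trans ?_
    have hpt : ∀ ω, B.indicator 1 (P.rbSolMap Λ N T_L T_R (j * τ) x (pairPath ω)) *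
        ENNReal.ofReal (Real.exp (θ * P.rbEnergy N (P.rbSolMap Λ N T_L T_R (j * τ) x (pairPath ω)))) ≤
        ENNReal.ofReal (Real.exp (θ * E / 2)) := by
      intro ω
      by_cases hω : P.rbSolMap Λ N T_L T_R (j * τ) x (pairPath ω) ∈ B
      · rw [Set.indicator_of_mem hω, Pi.one_apply, one_mul]
        refine ENNReal.ofReal_le_ofReal (Real.exp_le_exp.2 ?_)
        have : G (P.rbSolMap Λ N T_L T_R (j * τ) x (pairPath ω)) < E / 2 := hω
        nlinarith only [this, hθ]
      · rw [Set.indicator_of_notMem hω, zero_mul]; exact bot_le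
    calc ENNReal.ofReal (Real.exp (Cst * (tstar - j * τ))) *
          ∫⁻ ω, B.indicator 1 (P.rbSolMap Λ N T_L T_R (j * τ) x (pairPath ω)) *
            ENNReal.ofReal (Real.exp (θ * P.rbEnergy N (P.rbSolMap Λ N T_L T_R (j * τ) x (pairPath ω)))) ∂wienerPair
        ≤ ENNReal.ofReal (Real.exp (Cst * tstar)) * ∫⁻ _ω, ENNReal.ofReal (Real.exp (θ * E / 2)) ∂wienerPair := by
          refine mul_le_mul' (ENNReal.ofReal_le_ofReal (Real.exp_le_exp.2 ?_)) (lintegral_mono hpt)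
          have : tstar - j * τ ≤ tstar := by
            have : (0 : ℝ) ≤ j * τ := by positivity
            linarith only [this]
          exact mul_le_mul_of_nonneg_left this hCst0
      _ = _ := by
          rw [lintegral_const, measure_univ, mul_one, ← ENNReal.ofReal_mul (Real.exp_pos _).le]
  -- (T3) the bad events: Hölder, Chebyshev and the Brownian oscillation tail
  have hU_le : ∀ j ∈ range (J + 1), wienerPair (U j) ≤
      ENNReal.ofReal (Real.exp (-(θ * (3 * E / 2))) * (Real.exp (Cst * tstar) * Real.exp (θ * E))) := by
    intro j hj
    have hj' := mem_range.1 hj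
    have hsj : (((j : ℝ) * τ).toNNReal : ℝ) = j * τ := Real.coe_toNNReal _ (by positivity)
    have h := rb_measure_lt_rbEnergy_rbSolMap_le hU hV hk1 hk1 hγ0 Λ N hTL hTR hθ hθ'
      ((j : ℝ) * τ).toNNReal x (3 * E / 2)
    rw [hsj] at h
    refine h.trans (ENNReal.ofReal_le_ofReal ?_)
    refine mul_le_mul_of_nonneg_left (mul_le_mul_of_nonneg_right (Real.exp_le_exp.2 ?_) (Real.exp_pos _).le)
      (Real.exp_pos _).le
    exact mul_le_mul_of_nonneg_left (hjτ j hj') hCst0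
  have hNb_le : ∀ j ∈ range J, wienerPair (Nb j) ≤
      2 * ENNReal.ofReal (2 * τ ^ 2 / (m' ^ 2 - τ) ^ 2) := by
    intro j _
    have h := measure_pairShift_not_mem_goodPaths ((j : ℝ) * τ).toNNReal m' τ.toNNReal
    simp only [hNb]
    rw [h]
    have hτ' : ((τ.toNNReal : ℝ≥0) : ℝ) = τ := Real.coe_toNNReal τ hτ0.le
    have hlt : ((τ.toNNReal : ℝ≥0) : ℝ) < m' ^ 2 := by
      rw [hτ']
      have : 0 < m' ^ 2 := by positivity
      linarith only [hτsmall, this]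
    have := measure_compl_goodEvent_le hm'0 τ.toNNReal hlt
    rwa [hτ'] at this
  set u₁ : ℝ := Real.exp (-(θ * (3 * E / 2))) * (Real.exp (Cst * tstar) * Real.exp (θ * E)) with hu₁
  set u₂ : ℝ := 2 * τ ^ 2 / (m' ^ 2 - τ) ^ 2 with hu₂
  have hu₁0 : 0 ≤ u₁ := by positivity
  have hu₂0 : 0 ≤ u₂ := by positivity
  set Y : ℝ := (J + 1) * u₁ + J * (2 * u₂) with hY
  have hY0 : 0 ≤ Y := by positivity
  have hJ' : ENNReal.ofReal ((J : ℝ) + 1) = (J : ℝ≥0∞) + 1 := by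
    rw [ENNReal.ofReal_add (Nat.cast_nonneg J) zero_le_one, ENNReal.ofReal_natCast, ENNReal.ofReal_one]
  have hS₃_le : wienerPair S₃ ≤ ENNReal.ofReal Y := by
    calc wienerPair S₃ ≤ wienerPair (⋃ j ∈ range (J + 1), U j) + wienerPair (⋃ j ∈ range J, Nb j) :=
          measure_union_le _ _
      _ ≤ (∑ j ∈ range (J + 1), wienerPair (U j)) + ∑ j ∈ range J, wienerPair (Nb j) :=
          add_le_add (measure_biUnion_finset_le _ _) (measure_biUnion_finset_le _ _)
      _ ≤ (∑ j ∈ range (J + 1), ENNReal.ofReal u₁) + ∑ j ∈ range J, 2 * ENNReal.ofReal u₂ :=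
          add_le_add (Finset.sum_le_sum hU_le) (Finset.sum_le_sum hNb_le)
      _ = ENNReal.ofReal Y := by
          rw [Finset.sum_const, Finset.sum_const, card_range, card_range, nsmul_eq_mul, nsmul_eq_mul, hY,
            ENNReal.ofReal_add (by positivity : 0 ≤ ((J : ℝ) + 1) * u₁) (by positivity : 0 ≤ (J : ℝ) * (2 * u₂)),
            ENNReal.ofReal_mul (by positivity : 0 ≤ (J : ℝ) + 1), ENNReal.ofReal_mul (Nat.cast_nonneg J),
            ENNReal.ofReal_mul (by norm_num : (0 : ℝ) ≤ 2), ENNReal.ofReal_ofNat, ENNReal.ofReal_natCast, hJ']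
          push_cast
          rfl
  have hT3 : ∫⁻ ω, S₃.indicator F ω ∂wienerPair ≤
      ENNReal.ofReal (Real.exp (Cst * tstar) * Real.exp (θ * E)) * ENNReal.ofReal Y ^ (1 / q) := by
    have hind : ∀ ω, S₃.indicator F ω = S₃.indicator 1 ω * F ω := fun ω => by
      by_cases hω : ω ∈ S₃
      · rw [Set.indicator_of_mem hω, Set.indicator_of_mem hω, Pi.one_apply, one_mul]
      · rw [Set.indicator_of_notMem hω, Set.indicator_of_notMem hω, zero_mul]
    simp_rw [hind]
    have h := rb_lintegral_indicator_exp_rbEnergy_le_rpow hU hV hk1 hk1 hγ0 Λ N hTL hTR hθ hp1 hpθ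
      tstar.toNNReal x hS₃m
    rw [Real.coe_toNNReal tstar hts.le] at h
    refine h.trans ?_
    rw [← hq]
    gcongr
  ----------------------------------------------------------------
  -- Step 5: assemble
  ----------------------------------------------------------------
  have hsum : ∫⁻ ω, F ω ∂wienerPair ≤
      ENNReal.ofReal (Real.exp (-(κ * g)) * Real.exp (θ * E + Cst * tstar)) +
      (J + 1) * ENNReal.ofReal (Real.exp (Cst * tstar) * Real.exp (θ * E / 2)) +
      ENNReal.ofReal (Real.exp (Cst * tstar) * Real.exp (θ * E)) * ENNReal.ofReal Y ^ (1 / q) := by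
    calc ∫⁻ ω, F ω ∂wienerPair
        ≤ ∫⁻ ω, (SΓ.indicator F ω + (∑ j ∈ range (J + 1), (D j).indicator F ω) + S₃.indicator F ω) ∂wienerPair :=
          lintegral_mono hdom
      _ = (∫⁻ ω, SΓ.indicator F ω ∂wienerPair) + (∑ j ∈ range (J + 1), ∫⁻ ω, (D j).indicator F ω ∂wienerPair) +
            ∫⁻ ω, S₃.indicator F ω ∂wienerPair := by
          rw [lintegral_add_right _ (hFm.indicator hS₃m), lintegral_add_left (hFm.indicator hSΓm),
            lintegral_finsetSum _ fun j _ => hFm.indicator (hDm j)]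
      _ ≤ _ := by
          refine add_le_add (add_le_add hT1 ?_) hT3
          calc ∑ j ∈ range (J + 1), ∫⁻ ω, (D j).indicator F ω ∂wienerPair
              ≤ ∑ j ∈ range (J + 1), ENNReal.ofReal (Real.exp (Cst * tstar) * Real.exp (θ * E / 2)) :=
                Finset.sum_le_sum hT2
            _ = _ := by rw [Finset.sum_const, card_range, nsmul_eq_mul]; push_cast; ring
  -- everything as one real number
  set X₁ : ℝ := Real.exp (-(κ * g)) * Real.exp (θ * E + Cst * tstar) with hX₁
  set X₂ : ℝ := Real.exp (Cst * tstar) * Real.exp (θ * E / 2) with hX₂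
  set X₃ : ℝ := Real.exp (Cst * tstar) * Real.exp (θ * E) with hX₃
  have hX₁0 : 0 ≤ X₁ := by rw [hX₁]; positivity
  have hX₂0 : 0 ≤ X₂ := by rw [hX₂]; positivity
  have hX₃0 : 0 ≤ X₃ := by rw [hX₃]; positivity
  have hreal : ENNReal.ofReal (X₁ + (J + 1) * X₂ + X₃ * Y ^ (1 / q)) =
      ENNReal.ofReal X₁ + (J + 1) * ENNReal.ofReal X₂ + ENNReal.ofReal X₃ * ENNReal.ofReal Y ^ (1 / q) := by
    have h1 : 0 ≤ ((J : ℝ) + 1) * X₂ := by positivity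
    have h2 : 0 ≤ X₃ * Y ^ (1 / q) := by positivity
    have h3 : 0 ≤ X₁ + ((J : ℝ) + 1) * X₂ := by positivity
    rw [ENNReal.ofReal_add h3 h2, ENNReal.ofReal_add hX₁0 h1, ENNReal.ofReal_mul (by positivity : 0 ≤ (J : ℝ) + 1),
      ENNReal.ofReal_mul hX₃0, ENNReal.ofReal_rpow_of_nonneg hY0 hq0.le, hJ']
  ----------------------------------------------------------------
  -- Step 6: the real inequality `X₁ + (J+1)X₂ + X₃ Y^{1/q} ≤ e^{θE} Bf(E) ≤ e^{θE}/2`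
  ----------------------------------------------------------------
  have hEexp : Real.exp (θ * E) * Real.exp (-(θ / 2 * E)) = Real.exp (θ * E / 2) := by
    rw [← Real.exp_add]; congr 1; ring
  have hterm1 : X₁ = Real.exp (θ * E) * (Real.exp (Cst * tstar) * Real.exp (-(2 * κ * P.γ * ε₁ * E ^ (2 / k)))) := by
    rw [hX₁, hg, Real.exp_add]
    have : -(κ * (2 * P.γ * ε₁ * E ^ (2 / k))) = -(2 * κ * P.γ * ε₁ * E ^ (2 / k)) := by ring
    rw [this]; ring
  have hterm2 : (J + 1) * X₂ ≤ Real.exp (θ * E) * ((4 * E + 1) * Real.exp (Cst * tstar) * Real.exp (-(θ / 2 * E))) := by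
    rw [hX₂, ← hEexp]
    have h0 : 0 ≤ Real.exp (Cst * tstar) * (Real.exp (θ * E) * Real.exp (-(θ / 2 * E))) := by positivity
    calc ((J : ℝ) + 1) * (Real.exp (Cst * tstar) * (Real.exp (θ * E) * Real.exp (-(θ / 2 * E))))
        ≤ (4 * E + 1) * (Real.exp (Cst * tstar) * (Real.exp (θ * E) * Real.exp (-(θ / 2 * E)))) :=
          mul_le_mul_of_nonneg_right (by linarith only [hJr]) h0
      _ = _ := by ring
  -- `J · 2u₂ ≤ C₂ E^{-2/k}`
  have hu₂_le : u₂ ≤ 32 * Λ₀ ^ 2 * tE ^ 2 / m' ^ 4 := by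
    rw [hu₂]
    have hden : m' ^ 2 / 2 ≤ m' ^ 2 - τ := by linarith only [hτsmall]
    have hden0 : 0 < m' ^ 2 / 2 := by positivity
    have h1 : 2 * τ ^ 2 / (m' ^ 2 - τ) ^ 2 ≤ 2 * τ ^ 2 / (m' ^ 2 / 2) ^ 2 := by
      refine div_le_div_of_nonneg_left (by positivity) (by positivity) ?_
      exact pow_le_pow_left₀ hden0.le hden 2
    refine h1.trans ?_
    have hτ2' : τ ^ 2 ≤ (2 * Λ₀ * tE) ^ 2 := pow_le_pow_left₀ hτ0.le hτ2 2
    have hm'p : 0 < m' := by positivity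
    rw [div_le_div_iff₀ (by positivity) (by positivity)]
    have : 2 * τ ^ 2 * m' ^ 4 ≤ 2 * (2 * Λ₀ * tE) ^ 2 * m' ^ 4 :=
      mul_le_mul_of_nonneg_right (by linarith only [hτ2']) (by positivity)
    refine this.trans (le_of_eq ?_)
    ring
  have hJu₂ : (J : ℝ) * (2 * u₂) ≤ C₂ * E ^ (-(2 / k)) := by
    have hm'4 : m' ^ 4 = m₁ ^ 4 * (E ^ (2 / k) * E ^ (2 / k)) := by
      rw [hm', mul_pow]
      congr 1
      rw [← Real.rpow_add hE0, ← Real.rpow_natCast, ← Real.rpow_mul hE0.le]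
      congr 1; push_cast; ring
    have hEt : E * tE ^ 2 = E ^ (2 / k) := by
      have hne : 1 + (1 / k - 1 / 2 + (1 / k - 1 / 2)) ≠ 0 := by intro h; linarith only [h, hk']
      show E * timeScale k E ^ 2 = E ^ (2 / k)
      rw [timeScale, sq, ← Real.rpow_add hE0, ← Real.rpow_one_add' hE0.le hne]
      congr 1; ring
    have hE2k : 0 < E ^ (2 / k) := Real.rpow_pos_of_pos hE0 _
    have hneg : E ^ (-(2 / k)) = (E ^ (2 / k))⁻¹ := Real.rpow_neg hE0.le _
    calc (J : ℝ) * (2 * u₂) ≤ (4 * E) * (2 * (32 * Λ₀ ^ 2 * tE ^ 2 / m' ^ 4)) :=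
          mul_le_mul hJr (by linarith only [hu₂_le]) (by positivity) (by positivity)
      _ = 256 * Λ₀ ^ 2 * (E * tE ^ 2) / m' ^ 4 := by ring
      _ = C₂ * E ^ (-(2 / k)) := by
          rw [hEt, hm'4, hC₂, hneg]
          field_simp
  have hY_le : Y ≤ (4 * E + 1) * Real.exp (Cst * tstar) * Real.exp (-(θ / 2 * E)) + C₂ * E ^ (-(2 / k)) := by
    rw [hY]
    refine add_le_add ?_ hJu₂
    rw [hu₁]
    have he : Real.exp (-(θ * (3 * E / 2))) * (Real.exp (Cst * tstar) * Real.exp (θ * E)) =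
        Real.exp (Cst * tstar) * Real.exp (-(θ / 2 * E)) := by
      rw [mul_comm, mul_assoc, ← Real.exp_add]; congr 1; ring_nf
    rw [he]
    have h0 : 0 ≤ Real.exp (Cst * tstar) * Real.exp (-(θ / 2 * E)) := by positivity
    calc ((J : ℝ) + 1) * (Real.exp (Cst * tstar) * Real.exp (-(θ / 2 * E)))
        ≤ (4 * E + 1) * (Real.exp (Cst * tstar) * Real.exp (-(θ / 2 * E))) :=
          mul_le_mul_of_nonneg_right (by linarith only [hJr]) h0
      _ = _ := by ring
  have hterm3 : X₃ * Y ^ (1 / q) ≤ Real.exp (θ * E) * (Real.exp (Cst * tstar) *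
      ((4 * E + 1) * Real.exp (Cst * tstar) * Real.exp (-(θ / 2 * E)) + C₂ * E ^ (-(2 / k))) ^ (1 / q)) := by
    rw [hX₃]
    have hrp := Real.rpow_le_rpow hY0 hY_le hq0.le
    calc Real.exp (Cst * tstar) * Real.exp (θ * E) * Y ^ (1 / q)
        ≤ Real.exp (Cst * tstar) * Real.exp (θ * E) *
            ((4 * E + 1) * Real.exp (Cst * tstar) * Real.exp (-(θ / 2 * E)) + C₂ * E ^ (-(2 / k))) ^ (1 / q) :=
          mul_le_mul_of_nonneg_left hrp (by positivity)
      _ = _ := by ring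
  have hfinal : X₁ + (J + 1) * X₂ + X₃ * Y ^ (1 / q) ≤ Real.exp (θ * E) * Bf E := by
    rw [hterm1, hBf]
    simp only
    nlinarith only [hterm2, hterm3, Real.exp_pos (θ * E)]
  have hhalf : Real.exp (θ * E) * Bf E ≤ Real.exp (θ * E) / 2 := by
    have := hBa.le
    nlinarith only [this, Real.exp_pos (θ * E)]
  calc ∫⁻ ω, F ω ∂wienerPair ≤ _ := hsum
    _ = ENNReal.ofReal (X₁ + (J + 1) * X₂ + X₃ * Y ^ (1 / q)) := hreal.symm
    _ ≤ ENNReal.ofReal (Real.exp (θ * E) / 2) := ENNReal.ofReal_le_ofReal (hfinal.trans hhalf)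

end Main

/-! ### Theorem 3.10 for the constructed kernels (`k₁ = k₂`) -/

section Thm310

variable {P : OscillatorChain} {k : ℝ} (hU : RBGrowth P.U k) (hV : RBGrowth P.V k) (hk : 2 ≤ k)
  (hγ : 0 < P.γ) {Λ : ℝ} (hΛ : Λ ≠ 0) (hN : 0 < N) {T_L T_R : ℝ} (hTL : 0 < T_L) (hTR : 0 < T_R)
include hU hV hk hγ hΛ hN hTL hTR

/-- **Rey-Bellet–Thomas 2002, Theorem 3.10 (the Liapunov bound (39)), PROVED for `k₁ = k₂`**:
for the transition kernels `rbKernel` of (RBT-SDE) with H1–H2 at equal growth exponents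
`k ≥ 2`, `γ > 0`, `Λ ≠ 0`, `N ≥ 1`, `T_L, T_R > 0`: for every `s > 0` and
`0 < θ < 1/max(T_L, T_R)` there are a compact `U = {G ≤ E₀}`, `κ = ½ < 1` and
`L = e^{γ(T_L+T_R)θs} e^{θE₀}` with `T^s e^{θG}(x) ≤ κ e^{θG(x)} + L 1_U(x)` for all `x` ((26) on `U`,
`rb_lintegral_exp_rbEnergy_small` off `U`). [cite: ReyBelletThomas2002, Thm 3.10] -/
theorem OscillatorChain.rb_thm310 :
    ∀ s : ℝ≥0, 0 < s → ∀ θ : ℝ, 0 < θ → θ < 1 / max T_L T_R →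
      ∃ (U : Set (RBPhaseSpace N)) (κ L : ℝ), IsCompact U ∧ κ < 1 ∧
        ∀ x, ∫⁻ y, ENNReal.ofReal (Real.exp (θ * P.rbEnergy N y)) ∂(P.rbKernel Λ N T_L T_R s x) ≤
          ENNReal.ofReal (κ * Real.exp (θ * P.rbEnergy N x) + L * U.indicator 1 x) := by
  intro s hs θ hθ hθ'
  have hk1 : 1 ≤ k := by linarith
  obtain ⟨E₀, hE₀⟩ := rb_lintegral_exp_rbEnergy_small hU hV hk hγ hΛ hN hTL hTR hθ hθ' (tstar := (s : ℝ))
    (by exact_mod_cast hs)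
  set U : Set (RBPhaseSpace N) := {z | P.rbEnergy N z ≤ E₀} with hUdef
  set L : ℝ := Real.exp (P.γ * (T_L + T_R) * θ * s) * Real.exp (θ * E₀) with hL
  have hmeas := rb_measurable_exp_rbEnergy hU hV hk1 hk1 hγ.le N hTL hTR hθ hθ'
  refine ⟨U, 1 / 2, L, P.isCompact_setOf_rbEnergy_le hU hV hk1 hk1 N E₀, by norm_num, fun x => ?_⟩
  rw [OscillatorChain.lintegral_rbKernel hU hV hk1 hk1 hγ.le Λ N T_L T_R s x hmeas]
  by_cases hx : x ∈ U
  · have h26 := rb_lintegral_exp_rbEnergy_rbSolMap_le hU hV hk1 hk1 hγ.le Λ N hTL hTR hθ hθ' s x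
    refine h26.trans (ENNReal.ofReal_le_ofReal ?_)
    rw [Set.indicator_of_mem hx, Pi.one_apply, mul_one]
    have hxE : P.rbEnergy N x ≤ E₀ := hx
    have h1 : Real.exp (P.γ * (T_L + T_R) * θ * s) * Real.exp (θ * P.rbEnergy N x) ≤ L := by
      rw [hL]
      exact mul_le_mul_of_nonneg_left (Real.exp_le_exp.2 (mul_le_mul_of_nonneg_left hxE hθ.le)) (Real.exp_pos _).le
    have h2 : 0 ≤ 1 / 2 * Real.exp (θ * P.rbEnergy N x) := by positivity
    linarith only [h1, h2]
  · have hxE : E₀ ≤ P.rbEnergy N x := le_of_lt (not_le.1 hx)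
    refine (hE₀ x hxE).trans (ENNReal.ofReal_le_ofReal ?_)
    rw [Set.indicator_of_notMem hx, mul_zero, add_zero]
    linarith only [Real.exp_pos (θ * P.rbEnergy N x)]

end Thm310

/-! ### Theorem 2.1 for `k₁ = k₂` -/

/-- **Rey-Bellet–Thomas 2002, Theorem 2.1 for equal growth exponents `k₁ = k₂ = k ≥ 2`, PROVED**
(the statement of the named fact `ReyBelletThomas2002_thm21` restricted to `k₁ = k₂`, the case
covered by the printed scaling argument of §3.1): under H1–H2 with `RBGrowth U k`, `RBGrowth V k`,
`γ, Λ > 0`, `N ≥ 2`, `T_L, T_R > 0`, there is a Markov semigroup of `L` (the constructed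
`rbSemigroup`) with jointly smooth transition densities, a unique invariant probability measure with
a smooth everywhere positive density, `e^{θG}`-exponential convergence and exponential decay of
correlations for every `0 < θ < 1/max(T_L, T_R)` — assembled from Theorem 3.10 (`rb_thm310`),
Prop. 4.2 (`rb_irreducible`) and Hörmander's theorem (`hormander1967_thm11_proof`) by
`ReyBelletThomas2002_thm21_of_inputs_irreducible`. [cite: ReyBelletThomas2002, Thm 2.1] -/
theorem ReyBelletThomas2002_thm21_of_eq (P : OscillatorChain) (Λ k : ℝ) (hk : 2 ≤ k)
    (hU : RBGrowth P.U k) (hV : RBGrowth P.V k) (hV2 : RBNondegenerate P.V) (hγ : 0 < P.γ) (hΛ : 0 < Λ)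
    (N : ℕ) (T_L T_R : ℝ) (hN : 2 ≤ N) (hL : 0 < T_L) (hR : 0 < T_R) :
    ∃ S : MarkovSemigroupFor (P.rbGenerator Λ N T_L T_R),
      (∃ p : ℝ → RBPhaseSpace N → RBPhaseSpace N → ℝ,
        ContDiffOn ℝ ((⊤ : ℕ∞) : WithTop ℕ∞) (fun w : ℝ × RBPhaseSpace N × RBPhaseSpace N => p w.1 w.2.1 w.2.2)
          (Set.Ioi (0 : ℝ) ×ˢ Set.univ) ∧
        ∀ t : ℝ≥0, 0 < t → ∀ x : RBPhaseSpace N,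
          S.kernel t x = (volume : Measure (RBPhaseSpace N)).withDensity
            fun y => ENNReal.ofReal (p t x y)) ∧
      ∃ μ : Measure (RBPhaseSpace N), IsProbabilityMeasure μ ∧ S.IsInvariant μ ∧
        (∀ ν : Measure (RBPhaseSpace N), IsProbabilityMeasure ν → S.IsInvariant ν → ν = μ) ∧
        HasSmoothPosDensity μ ∧
        ∀ θ : ℝ, 0 < θ → θ < 1 / max T_L T_R →
          Integrable (fun y => Real.exp (θ * P.rbEnergy N y)) μ ∧
          (∀ (t : ℝ≥0) (x : RBPhaseSpace N),
            Integrable (fun y => Real.exp (θ * P.rbEnergy N y)) (S.kernel t x)) ∧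
          ∃ r R : ℝ, 1 < r ∧ 0 ≤ R ∧
            (∀ (x : RBPhaseSpace N) (t : ℝ≥0) (f : RBPhaseSpace N → ℝ), Measurable f →
              (∀ y, |f y| ≤ Real.exp (θ * P.rbEnergy N y)) →
              |S.act t f x - ∫ y, f y ∂μ| ≤
                R * r ^ (-(t : ℝ)) * Real.exp (θ * P.rbEnergy N x)) ∧
            (∀ (t : ℝ≥0) (f g : RBPhaseSpace N → ℝ) (a b : ℝ), 0 < (t : ℝ) →
              Measurable f → Measurable g →
              (∀ y, f y ^ 2 ≤ a * Real.exp (θ * P.rbEnergy N y)) →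
              (∀ y, g y ^ 2 ≤ b * Real.exp (θ * P.rbEnergy N y)) →
              |∫ y, g y * S.act t f y ∂μ - (∫ y, f y ∂μ) * ∫ y, g y ∂μ| ≤
                R * r ^ (-(t : ℝ)) * Real.sqrt a * Real.sqrt b) :=
  ReyBelletThomas2002_thm21_of_inputs_irreducible Literature.Analysis.Hypoelliptic.hormander1967_thm11_proof
    hk le_rfl hU hV hV2 hγ hΛ hN hL hR
    (OscillatorChain.rb_thm310 hU hV hk hγ hΛ.ne' (by omega) hL hR)
    fun z U hUo hne => OscillatorChain.rb_irreducible hU hV (by linarith) (by linarith) hγ.le hγ hΛ.ne'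
      (by omega) hL hR z U hUo hne


end Literature.MathematicalPhysics.KineticTheory.HeatConduction

end
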